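import Summits.ResolutionOfSingularities.ResolutionOfSingularities.Theorems.WeightedInvariantLocalWeightedDropTrackCSurfaceGermsWonB
import Summits.ResolutionOfSingularities.ResolutionOfSingularities.Theorems.WeightedInvariantLocalWeightedDropTrackCNCStep
import Summits.ResolutionOfSingularities.ResolutionOfSingularities.Theorems.WeightedInvariantLocalWeightedDropTrackCNCPayload

/-!
# Track C with a graded payload: the tautological frame at the closed point (BASE) and the induction along the corrected
# Cossart–Jannsen–Saito sequence

[OURS · L1 W4.3 · chain w43, engine crux `LocalWeightedDrop` stmt-ResolutionOfSingularities-8899; res-type-088, piece (A3-β)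
of strategist res-L1-w43-strat-1's line `tame-four-tuple-drop`] NOT a statement of any manuscript.

For a germ `b ∈ k⟦x₀,x₁,x₂⟧` and a predicate `W` on germs, write `Tower(W, σ)` for «at every framed point `z` of the
`Z₀`-scheme `σ : Z ⟶ Z₀ = Spec k⟦x₀,x₁,x₂⟧` and every Cohen frame `F` at `z`, every NON-ZERO divisor of the total transform
of `b` read in `F` satisfies `W`» (spelled out in each statement).

* `exists_frame_closedPoint` — the TAUTOLOGICAL FRAME at the closed point of `Z₀` (the local ring there is `k⟦x⟧`, already
  complete), in which the total transform of every `f` along `𝟙 Z₀` reads as `f` itself (the payload-free content of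
  `TrackC.won_of_wonAt_id`).
* `base_of_tower` — BASE: `Tower(W, 𝟙 Z₀) → W b` for `b ≠ 0`.
* `closure_subset_preimage_of_seqB`, `support_subset_preimage_of_seqB` — along `IsBPermissibleSequenceB X B σ X' B'` from a
  closed `X`: `closure X' ⊆ σ⁻¹ X`, hence every centre lies over `X`.
* `exists_level_of_CJSB` — ASSEMBLY ((A3-β) in payload-parametric form): F-32bR puts every non-zero germ in some
  level of a graded payload whose level `0` contains the normal crossings.
* `exists_tower_id_of_tower` — INDUCTION for a GRADED payload `W : ℕ → _` (monotone, each `W (n+1)` closed under the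
  count's move towards `W n`, `TrackC.ncStep`): `Tower(W n, σ)` at the top of a corrected CJS sequence of `(V(b), B)`
  (`B` proper closed) gives `Tower(W n', 𝟙 Z₀)` for some `n'`.
-/

noncomputable section

open CategoryTheory CategoryTheory.Limits AlgebraicGeometry TopologicalSpace IsLocalRing
open Literature.AlgebraicGeometry.Resolution
open Scheme.IdealSheafData

set_option linter.dupNamespace false -- mandated namespace of this single-conjunct summit

namespace Summit.ResolutionOfSingularities.ResolutionOfSingularities.Theorems.TrackC

variable {k : Type} [Field k]

/-! ## BASE: the tautological frame at the closed point -/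

/-- **The tautological frame.** At the closed point of `Z₀ = Spec k⟦x₀,x₁,x₂⟧` there is a Cohen frame in which the total
transform of every `f` along `𝟙 Z₀` reads as `f` (`𝒪_{Z₀,0} = k⟦x⟧` is already complete: `IsLocalization.atUnits`,
`AdicCompletion.ofAlgEquiv`). [OURS · folklore] -/
theorem exists_frame_closedPoint (k : Type) [Field k] :
    ∃ (hN : IsNoetherianRing ((Spec (.of (MvPowerSeries (Fin 3) k))).presheaf.stalk
        (closedPoint (MvPowerSeries (Fin 3) k))))
      (F : @Frame k _ (Spec (.of (MvPowerSeries (Fin 3) k))) (𝟙 _) (closedPoint (MvPowerSeries (Fin 3) k)) hN),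
      ∀ f : MvPowerSeries (Fin 3) k,
        F.e (algebraMap _ _ (totalGerm (𝟙 (Spec (.of (MvPowerSeries (Fin 3) k))))
          (closedPoint (MvPowerSeries (Fin 3) k)) f)) = f := by
  let z₀ : Spec (.of (MvPowerSeries (Fin 3) k)) := closedPoint (MvPowerSeries (Fin 3) k)
  let O : Type := (Spec (.of (MvPowerSeries (Fin 3) k))).presheaf.stalk z₀
  letI : Algebra (MvPowerSeries (Fin 3) k) O := StructureSheaf.stalkAlgebra (MvPowerSeries (Fin 3) k) z₀
  haveI : IsLocalization.AtPrime O (maximalIdeal (MvPowerSeries (Fin 3) k)) :=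
    StructureSheaf.IsLocalization.to_stalk (MvPowerSeries (Fin 3) k) z₀
  haveI hRN : IsNoetherianRing (MvPowerSeries (Fin 3) k) := isNoetherianRing_mvPowerSeries (Fin 3) (R := k)
  have H : (maximalIdeal (MvPowerSeries (Fin 3) k)).primeCompl ≤ IsUnit.submonoid (MvPowerSeries (Fin 3) k) :=
    fun x hx => by
      change IsUnit x
      by_contra hux
      exact hx ((IsLocalRing.mem_maximalIdeal x).mpr (mem_nonunits_iff.mpr hux))
  let ι : MvPowerSeries (Fin 3) k ≃ₐ[MvPowerSeries (Fin 3) k] O :=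
    IsLocalization.atUnits (MvPowerSeries (Fin 3) k) (maximalIdeal (MvPowerSeries (Fin 3) k)).primeCompl H
  have hι : ∀ r : MvPowerSeries (Fin 3) k, ι r = algebraMap (MvPowerSeries (Fin 3) k) O r := fun r => by
    simpa using ι.commutes r
  haveI hN : IsNoetherianRing O := isNoetherianRing_of_ringEquiv (MvPowerSeries (Fin 3) k) ι.toRingEquiv
  haveI : IsAdicComplete (maximalIdeal (MvPowerSeries (Fin 3) k)) (MvPowerSeries (Fin 3) k) := by
    rw [maximalIdeal_mvPowerSeries_eq_span]
    infer_instance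
  haveI : IsAdicComplete (maximalIdeal O) O := by
    have h1 := (IsAdicComplete.congr_ringEquiv (maximalIdeal (MvPowerSeries (Fin 3) k)) ι.toRingEquiv).mpr ‹_›
    rwa [map_ringEquiv_maximalIdeal] at h1
  let e : AdicCompletion (maximalIdeal O) O ≃+* MvPowerSeries (Fin 3) k :=
    (AdicCompletion.ofAlgEquiv (maximalIdeal O)).symm.toRingEquiv.trans ι.symm.toRingEquiv
  have he : ∀ r : MvPowerSeries (Fin 3) k, e (algebraMap O _ (algebraMap (MvPowerSeries (Fin 3) k) O r)) = r :=
    fun r => by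
      change ι.symm ((AdicCompletion.ofAlgEquiv (maximalIdeal O)).symm
        (AdicCompletion.of (maximalIdeal O) O (algebraMap (MvPowerSeries (Fin 3) k) O r))) = r
      rw [AdicCompletion.ofAlgEquiv_symm_of, ← hι, AlgEquiv.symm_apply_apply]
  have hgerm : ∀ r : MvPowerSeries (Fin 3) k, (Spec (.of (MvPowerSeries (Fin 3) k))).presheaf.germ ⊤ z₀ trivial
      ((Scheme.ΓSpecIso (.of (MvPowerSeries (Fin 3) k))).inv.hom r) =
        algebraMap (MvPowerSeries (Fin 3) k) O r := fun r => rfl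
  have hid : ∀ r : MvPowerSeries (Fin 3) k,
      (𝟙 (Spec (.of (MvPowerSeries (Fin 3) k))) : Spec (.of (MvPowerSeries (Fin 3) k)) ⟶ _).appTop.hom
        ((Scheme.ΓSpecIso (.of (MvPowerSeries (Fin 3) k))).inv.hom r) =
        (Scheme.ΓSpecIso (.of (MvPowerSeries (Fin 3) k))).inv.hom r := fun r => by
    rw [Scheme.Hom.id_appTop]; rfl
  let F : @Frame k _ (Spec (.of (MvPowerSeries (Fin 3) k))) (𝟙 _) z₀ hN :=
    { e := e
      map_const := fun a => by
        change e (algebraMap O _ ((Spec (.of (MvPowerSeries (Fin 3) k))).presheaf.germ ⊤ z₀ trivial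
          ((𝟙 (Spec (.of (MvPowerSeries (Fin 3) k))) : Spec (.of (MvPowerSeries (Fin 3) k)) ⟶ _).appTop.hom
            ((Scheme.ΓSpecIso (.of (MvPowerSeries (Fin 3) k))).inv.hom (MvPowerSeries.C a))))) = _
        rw [hid, hgerm, he] }
  refine ⟨hN, F, fun f => ?_⟩
  change e (algebraMap O _ ((Spec (.of (MvPowerSeries (Fin 3) k))).presheaf.germ ⊤ z₀ trivial
    ((𝟙 (Spec (.of (MvPowerSeries (Fin 3) k))) : Spec (.of (MvPowerSeries (Fin 3) k)) ⟶ _).appTop.hom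
      ((Scheme.ΓSpecIso (.of (MvPowerSeries (Fin 3) k))).inv.hom f)))) = f
  rw [hid, hgerm, he]

/-- **BASE.** If along `𝟙 Z₀` every non-zero divisor of the total transform of `b` in every frame satisfies `W`, then
`W b` (`b ≠ 0`): read `b ∣ b` in the tautological frame. [OURS · folklore] -/
theorem base_of_tower (W : MvPowerSeries (Fin 3) k → Prop) (b : MvPowerSeries (Fin 3) k) (hb : b ≠ 0)
    (h : ∀ (z : Spec (.of (MvPowerSeries (Fin 3) k)))
      (hN : IsNoetherianRing ((Spec (.of (MvPowerSeries (Fin 3) k))).presheaf.stalk z))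
      (F : @Frame k _ (Spec (.of (MvPowerSeries (Fin 3) k))) (𝟙 _) z hN) (g : MvPowerSeries (Fin 3) k),
      g ≠ 0 → g ∣ F.e (algebraMap _ _ (totalGerm (𝟙 (Spec (.of (MvPowerSeries (Fin 3) k)))) z b)) → W g) :
    W b := by
  obtain ⟨hN, F, hF⟩ := exists_frame_closedPoint k
  exact h _ hN F b hb (by rw [hF])

/-! ## Invariants along the corrected sequence: the strict transforms and the centres lie over `X` -/

variable {Z : Scheme.{0}} {X B : Set Z}

/-- Along a corrected `𝓑`-permissible sequence from a CLOSED `X`, the strict transform lies over `X`: `closure X' ⊆ σ⁻¹ X`.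
[OURS · folklore] -/
theorem closure_subset_preimage_of_seqB (hX : IsClosed X) {Z' : Scheme.{0}} {σ : Z' ⟶ Z} {X' B' : Set Z'}
    (hseq : IsBPermissibleSequenceB X B σ X' B') : closure X' ⊆ σ ⁻¹' X := by
  induction hseq with
  | refl =>
    rw [hX.closure_eq]
    intro x hx
    simpa using hx
  | @blowup Z' Z'' σ X' B' h C τ hτ hreg hsub hBsing hperm hnc ih =>
    have hcl : IsClosed (τ ⁻¹' closure X') := isClosed_closure.preimage τ.continuous
    rw [closure_closure]
    intro y hy
    have hXsub : X' \ (C.support : Set Z') ⊆ closure X' := fun x hx => subset_closure hx.1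
    have hy' : y ∈ τ ⁻¹' closure X' := closure_minimal (Set.preimage_mono hXsub) hcl hy
    have := ih hy'
    simpa [Set.mem_preimage, Scheme.Hom.comp_apply] using this

/-- A centre `C` with `𝓘_{closure X'} ≤ C` is supported inside `closure X'`. [OURS · folklore] -/
theorem support_subset_closure_of_le {Z' : Scheme.{0}} {X' : Set Z'} {C : Z'.IdealSheafData}
    (hsub : vanishingIdeal ⟨closure X', isClosed_closure⟩ ≤ C) : (C.support : Set Z') ⊆ closure X' := by
  intro x hx
  have hx' : x ∈ ((vanishingIdeal (⟨closure X', isClosed_closure⟩ : Closeds Z')).support : Set Z') :=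
    support_antitone hsub hx
  simpa [coe_support_vanishingIdeal] using hx'

/-! ## INDUCTION along the corrected sequence with a graded payload -/

/-- **INDUCTION (graded payload).** Let `W : ℕ → (k⟦X⟧ → Prop)` be monotone with each `W (n+1)` closed under the count's move
towards `W n` (the hypotheses `hmono`, `hmove`; cf. `TrackC.ncStep`).  Along a corrected `𝓑`-permissible sequence
`σ : Z' ⟶ Z₀` of `(V(b), B)` with `B` a proper closed subset of `Z₀ = Spec k⟦x₀,x₁,x₂⟧`: if at the top every non-zero divisor of
the total transform of `b` in every frame satisfies `W n`, then at the bottom (`𝟙 Z₀`) every such divisor satisfies `W n'`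
for some `n'`.  (Each blow-up step costs one level: `TrackC.ncStep`; integrality / local Noetherianity / the non-vanishing of
centres along the sequence: `TrackC.forwardB`, `TrackC.centre_ne_bot_B`.) [OURS · folklore] -/
theorem exists_tower_id_of_tower (b : MvPowerSeries (Fin 3) k) (W : ℕ → MvPowerSeries (Fin 3) k → Prop)
    (hmono : ∀ n g, W n g → W (n + 1) g)
    (hmove : ∀ (n : ℕ) (g : MvPowerSeries (Fin 3) k) (Φ : Fin 3 → MvPowerSeries (Fin 3) k) (w : Fin 3 → ℕ),
      (∀ i, MvPowerSeries.constantCoeff (Φ i) = 0) →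
      IsUnit (Matrix.det (Matrix.of fun i j => MvPowerSeries.coeff (Finsupp.single j 1) (Φ i))) →
      (∀ i, w i ≤ 1) → (∃ i, 0 < w i) →
      (∀ c : Fin 3 → k, (∀ i, w i = 0 → c i = 0) → c ≠ 0 →
        ∀ (A : ℕ) (G : MvPowerSeries (Fin (3 + 1)) k),
          MvPowerSeries.subst (CobordantChart.chart w c) (MvPowerSeries.subst Φ g) = MvPowerSeries.X 0 ^ A * G →
          ¬ (MvPowerSeries.X (0 : Fin (3 + 1)) ∣ G) →
          ∃ i : Fin 3, c i ≠ 0 ∧ W n (MvPowerSeries.X 0 * TupleGame.slice i G)) →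
      W (n + 1) g)
    {B : Set (Spec (.of (MvPowerSeries (Fin 3) k)))} (hB : IsClosed B) (hBne : B ≠ Set.univ)
    {Z' : Scheme.{0}} {σ : Z' ⟶ Spec (.of (MvPowerSeries (Fin 3) k))} {X' B' : Set Z'}
    (hseq : IsBPermissibleSequenceB ((Spec (.of (MvPowerSeries (Fin 3) k))).zeroLocus (U := ⊤)
      {(Scheme.ΓSpecIso (.of (MvPowerSeries (Fin 3) k))).inv.hom b} : Set _) B σ X' B') (n : ℕ)
    (h : ∀ (z : Z') (hN : IsNoetherianRing (Z'.presheaf.stalk z)) (F : @Frame k _ Z' σ z hN)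
      (g : MvPowerSeries (Fin 3) k), g ≠ 0 → g ∣ F.e (algebraMap _ _ (totalGerm σ z b)) → W n g) :
    ∃ n', ∀ (z : Spec (.of (MvPowerSeries (Fin 3) k)))
      (hN : IsNoetherianRing ((Spec (.of (MvPowerSeries (Fin 3) k))).presheaf.stalk z))
      (F : @Frame k _ (Spec (.of (MvPowerSeries (Fin 3) k))) (𝟙 _) z hN) (g : MvPowerSeries (Fin 3) k),
      g ≠ 0 → g ∣ F.e (algebraMap _ _ (totalGerm (𝟙 (Spec (.of (MvPowerSeries (Fin 3) k)))) z b)) → W n' g := by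
  haveI : IsDomain (MvPowerSeries (Fin 3) k) := NoZeroDivisors.to_isDomain _
  haveI : IsNoetherianRing (MvPowerSeries (Fin 3) k) := isNoetherianRing_mvPowerSeries (Fin 3) (R := k)
  induction hseq generalizing n with
  | refl => exact ⟨n, h⟩
  | @blowup Z' Z'' σ X' B' hs C τ hτ hreg hsub hBsing hperm hnc ih =>
    obtain ⟨hint, hnoeth, -, hB'c, hB'ne⟩ := forwardB hB hBne hs
    haveI := hint
    haveI := hnoeth
    have hC : C ≠ ⊥ := centre_ne_bot_B C hsub hBsing (genericPoint_not_mem_of_isClosed hB'c hB'ne)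
    have hsuppV : (C.support : Set Z') ⊆ σ ⁻¹' ((Spec (.of (MvPowerSeries (Fin 3) k))).zeroLocus (U := ⊤)
        {(Scheme.ΓSpecIso (.of (MvPowerSeries (Fin 3) k))).inv.hom b} : Set _) :=
      (support_subset_closure_of_le hsub).trans (closure_subset_preimage_of_seqB (isClosed_zeroLocus (k := k) b) hs)
    refine ih (n + 1) fun z hN F g hg0 hg => ?_
    exact ncStep b σ C τ hτ hreg hC hsuppV (W (n + 1)) (W n) (hmono n) (hmove n) h z hN F g hg0 hg


/-! ## ASSEMBLY: every non-zero germ reaches some level of a graded payload, modulo F-32bR -/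

/-- **(A3-β) TRANSFER, payload-parametric form.** Let `W : ℕ → (k⟦X₀,X₁,X₂⟧ → Prop)` be a graded payload with: level `0`
contains every NORMAL CROSSING (a germ that is a unit times a monomial after a legal coordinate change — the body of the
line's `SpaceIsNC`), the levels are monotone, and `W (n+1)` is closed under the count's move towards `W n`.  Then the
corrected Cossart–Jannsen–Saito sequence fact `CossartJannsenSaito2020EmbeddedSequenceB` (F-32bR) puts EVERY non-zero germ
`b` in some level `W n`: run the CJS-B sequence of `V(b) ⊆ Spec k⟦x₀,x₁,x₂⟧` (`exists_sequence_zeroLocusB`); at its end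
every divisor of the total transform is a normal crossing in every frame (`ncAt_end`), each blow-up step costs one level
downwards (`exists_tower_id_of_tower`), and at the bottom the tautological frame reads `b` itself (`base_of_tower`).
With res-type-056's `W n := WinsIn GermIsNC n` this is the totality input `∀ b ≠ 0, ∃ n, WinsIn GermIsNC n b` of the
line's count (A3). [OURS · L1 W4.3] -/
theorem exists_level_of_CJSB (hCJS : CossartJannsenSaito2020EmbeddedSequenceB.{0})
    (W : ℕ → MvPowerSeries (Fin 3) k → Prop)
    (hnc : ∀ (g : MvPowerSeries (Fin 3) k) (Φ : Fin 3 → MvPowerSeries (Fin 3) k) (v : MvPowerSeries (Fin 3) k)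
      (e : Fin 3 → ℕ), (∀ i, MvPowerSeries.constantCoeff (Φ i) = 0) →
      IsUnit (Matrix.det (Matrix.of fun i j => MvPowerSeries.coeff (Finsupp.single j 1) (Φ i))) →
      MvPowerSeries.constantCoeff v ≠ 0 → MvPowerSeries.subst Φ g = v * ∏ i, MvPowerSeries.X i ^ e i → W 0 g)
    (hmono : ∀ n g, W n g → W (n + 1) g)
    (hmove : ∀ (n : ℕ) (g : MvPowerSeries (Fin 3) k) (Φ : Fin 3 → MvPowerSeries (Fin 3) k) (w : Fin 3 → ℕ),
      (∀ i, MvPowerSeries.constantCoeff (Φ i) = 0) →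
      IsUnit (Matrix.det (Matrix.of fun i j => MvPowerSeries.coeff (Finsupp.single j 1) (Φ i))) →
      (∀ i, w i ≤ 1) → (∃ i, 0 < w i) →
      (∀ c : Fin 3 → k, (∀ i, w i = 0 → c i = 0) → c ≠ 0 →
        ∀ (A : ℕ) (G : MvPowerSeries (Fin (3 + 1)) k),
          MvPowerSeries.subst (CobordantChart.chart w c) (MvPowerSeries.subst Φ g) = MvPowerSeries.X 0 ^ A * G →
          ¬ (MvPowerSeries.X (0 : Fin (3 + 1)) ∣ G) →
          ∃ i : Fin 3, c i ≠ 0 ∧ W n (MvPowerSeries.X 0 * TupleGame.slice i G)) →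
      W (n + 1) g)
    (b : MvPowerSeries (Fin 3) k) (hb : b ≠ 0) : ∃ n, W n b := by
  obtain ⟨Z₁, π, X₁, B₁, hseq, hB₁, htot, htr⟩ := exists_sequence_zeroLocusB (k := k) hCJS b hb
  have hX₁c : IsClosed X₁ := isClosed_of_seqB hseq (isClosed_zeroLocus (k := k) b)
  haveI : Nonempty (Spec (.of (MvPowerSeries (Fin 3) k))) := ⟨closedPoint (MvPowerSeries (Fin 3) k)⟩
  have hB : IsClosed (∅ : Set (Spec (.of (MvPowerSeries (Fin 3) k)))) := isClosed_empty
  have hBne : (∅ : Set (Spec (.of (MvPowerSeries (Fin 3) k)))) ≠ Set.univ := Set.empty_ne_univ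
  have hT : ∀ z : Z₁, totalGerm π z b ≠ 0 := totalGerm_ne_zero_B hB hBne hseq hb
  have htop : ∀ (z : Z₁) (hN : IsNoetherianRing (Z₁.presheaf.stalk z)) (F : @Frame k _ Z₁ π z hN)
      (g : MvPowerSeries (Fin 3) k), g ≠ 0 → g ∣ F.e (algebraMap _ _ (totalGerm π z b)) → W 0 g := by
    intro z hN F g _ hg
    obtain ⟨Φ, v, e, hΦ0, hdet, hv, hge⟩ := ncAt_end b π X₁ B₁ hX₁c hB₁ htot htr hT z hN F g hg
    exact hnc g Φ v e hΦ0 hdet hv hge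
  obtain ⟨n', h'⟩ := exists_tower_id_of_tower b W hmono hmove hB hBne hseq 0 htop
  exact ⟨n', base_of_tower (W n') b hb h'⟩

end Summit.ResolutionOfSingularities.ResolutionOfSingularities.Theorems.TrackC

end
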